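import Literature.NumberTheory.Automorphic.SatakeTransformGL
import HarnessLib

/-!
# The Satake transform of `ℋ(GL_n(F), GL_n(𝒪))` with coefficients in a ring in which `q` is a unit ("mod `p`")

Topic `NumberTheory/Automorphic`; requested notion `satakeTransformModP` (route SmithKummer of
the Langlands summit: Satake parameters of `𝔽̄_p`-valued characters of spherical Hecke algebras,
Treumann–Venkatesh).  Everything in this file is **proved**; there is no named fact.

Setting: a field `F` with a `ValuativeRel` whose valuation ring `𝒪 = 𝒪[F]` is a discrete
valuation ring with residue field `𝓀` of cardinality `q` (e.g. a non-archimedean local field), a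
uniformizing element `ϖ`, `G = GL_n(F)`, `K = GL_n(𝒪) = glInt n F`, the Hecke algebra
`ℋ_R(G, K) = End_G(R[G ⧸ K])` (`heckeAlgebra R G K` of `HeckeAlgebra`, any commutative ring `R`)
with its double-coset basis `T_g` (`heckeAlgebra.doubleCosetOperator`), and a **coefficient ring
`R` in which `q` is a unit** (`hq : IsUnit (q : R)`): `R = 𝔽̄_p` or any field of characteristic
`p ∤ q` ("mod `p`", the case of Treumann–Venkatesh, `p ≠` residue characteristic), `R = ℤ[q⁻¹]`,
`R = ℂ`.  (For `p ∣ q`, i.e. `q = 0` in `R`, the mod-`p` Satake transform of Herzig /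
Henniart–Vignéras is a different map and is *not* what is defined here.)

## Main definitions and results

* `satakeTransformModP hϖ hq : ℋ_R(G, K) →ₐ[R] R[ℤⁿ]` (`AddMonoidAlgebra R (Fin n → ℤ)`), the
  **Satake transform with coefficients in `R`**,
  `𝒮_R(T) = ∑_{γ ∈ G/K} (T [K])(γ) · q^{-⟨ν, e(γ)⟩} · x^{e(γ)}`, `ν = (n-1, n-2, …, 0)`,
  `e(γ) ∈ ℤⁿ` the Iwasawa exponent (`iwasawaExp`, `γ = u ϖ^{e(γ)} K`) — the *same integral
  normalisation* as the transform `satakeTransform hϖ` over `ℂ` of `SatakeTransformGL`, which it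
  generalises: `satakeTransformModP_complex : satakeTransformModP hϖ hq = satakeTransform hϖ` for
  `R = ℂ`.  It is an **algebra homomorphism** (same proof as over `ℂ`: translation by the Borel part
  `u ϖ^m` of a representative multiplies the transform by the monomial `q^{-⟨ν, m⟩} x^m`; Cartier,
  Corvallis 1979, §IV.2, (4.2.3) and Thm. 4.1, step (a); Satake 1963, §6), the weight
  `q^{-⟨ν, e⟩} ∈ Rˣ` being the unit `satakeWeightUnit hq.unit e = hq.unit ^ (-⟨ν, e⟩)`.
* `satakeTransformModP_doubleCosetOperator_heckeDiag` (**the transform of `T_r`**, `r ≤ n`):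
  `𝒮_R(T_r) = q^{-r(r-1)/2} e_r(x)` (`q^{-1} = hq.unit⁻¹`), Tamagawa's computation
  (Shimura (1971), Thm. 3.21) in the integral normalisation, valid over any `R` since only `q` is
  inverted.
* `IsSatakeParameterModP hϖ hq θ α` (**Satake parameter of a character**): for a field `k` with
  `q ≠ 0` in `k`, a `k`-algebra map `θ : ℋ_k(G, K) → k` and a multiset `α` of units of `k`:
  `α = {a_1, …, a_n}` for a point `a ∈ (kˣ)ⁿ` with `θ = ev_a ∘ 𝒮_k` (`laurentEval a` of
  `TorusCharacters`), i.e. `θ(T) = 𝒮_k(T)(a)` — the parameter of the character by which `ℋ` acts on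
  the spherical line of an unramified principal series (Treumann–Venkatesh (2016), §7.6).  API:
  `card_eq` (`#α = n`), `apply_doubleCosetOperator_heckeDiag`
  (`θ(T_r) = q^{-r(r-1)/2} e_r(α)`), `unique` (the parameter of `θ` is unique, by Vieta),
  `isSatakeParameterModP_comp` (every `a` occurs).
* **Unramified twists**: `detExp hϖ g = v(det g) ∈ ℤ` (`valuation_det_eq_zpow_detExp`,
  `detExp_mul`); `unramifiedDetTwist hϖ c : ℋ_R(G, K) ≃ₐ[R] ℋ_R(G, K)` (`c ∈ Rˣ`), the twist by the
  unramified character `c^{v ∘ det}`, `τ_c(T_g) = c^{v(det g)} T_g`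
  (`unramifiedDetTwist_doubleCosetOperator`), realised as conjugation by `[γ] ↦ c^{v(det γ)} [γ]`
  on `R[G ⧸ K]`; `laurentTwist c : R[ℤⁿ] →ₐ[R] R[ℤⁿ]`, `x^e ↦ c^{|e|} x^e`; the intertwining
  `satakeTransformModP_unramifiedDetTwist : 𝒮_R(τ_c T) = laurentTwist c (𝒮_R T)` (as
  `v(det γ) = |e(γ)|`), `laurentEval_comp_laurentTwist : ev_a ∘ laurentTwist c = ev_{c a}`, and
  `IsSatakeParameterModP.twist`: if `θ` has parameter `α` then `θ ∘ τ_c` has parameter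
  `c α = {c α_1, …, c α_n}` (Arthur–Clozel (1989), Ch. 3, proof of Thm. 3.1,
  `t_{π ⊗ χ, v} = χ(ϖ_v) t_{π, v}`, here for Hecke characters with coefficients in `k`).

## Normalisations (no square root of `q`)

For `f = 𝟙_{KgK}` and `t = ϖ^e`, `∫_U f(t u) du = #{γ ∈ KgK/K : e(γ) = e}` (`vol(U ∩ K) = 1`), so
three transforms occur in the literature, all of the form
`T ↦ ∑_{γ ∈ G/K} (T [K])(γ) w(e(γ)) x^{e(γ)}` for a character `w : ℤⁿ → Rˣ`:
Treumann–Venkatesh's `𝒮*(f)(t) = ∫_U f(t u) du` (`w = 1`; (2016), §7.2, for which the Weyl group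
acts on the target through a `q`-twisted action), Satake's unitary
`𝒮 = δ^{1/2} 𝒮*` (`w(e) = q^{-⟨ρ, e⟩}`, `ρ = ((n-1)/2, …, -(n-1)/2)`, coefficients
`ℤ[q^{±1/2}]`; Cartier, Corvallis 1979, (4.2.3); Gross (1998), §3), and the **integral**
`𝒮_ν = |det|^{(n-1)/2} 𝒮` used here and in `SatakeTransformGL` (`w(e) = q^{-⟨ν, e⟩}`,
`ν = ρ + (n-1)/2 · (1, …, 1) ∈ ℤⁿ`, coefficients `ℤ[q⁻¹]`, usual `S_n`-action since `|det|` is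
`S_n`-invariant): `𝒮_ν(T)(x) = 𝒮(T)(q^{-(n-1)/2} x)`, e.g. `𝒮(T_i) = q^{i(n-i)/2} e_i(X)`
(Tamagawa) versus `𝒮_ν(T_i) = q^{-i(i-1)/2} e_i(x)` here.  Thus Scholze's elements
`T_{i,v} := e_i(X) ∈ 𝕋_v[q^{1/2}]` under the unitary isomorphism
`𝕋_v[q_v^{1/2}] ≅ ℤ_p[q_v^{1/2}][X_1^{±1}, …, X_n^{±1}]^{S_n}` ((2015), Ch. V, §4; p. 66 of
arXiv:1306.2070, where `q_v^{i(n+1)/2} T_{i,v} ∈ 𝕋_v` is noted) are `T_{i,v} = q^{-i(n-i)/2} T_i`,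
so `q^{i(n+1)/2} T_{i,v} = q^{i(i+1)/2} T_i`, and for a character `θ` with parameter `α` in the
present sense `θ` applied to the coefficients of `P_v(X) = ∑_i (-1)^i q^{i(n+1)/2} T_{i,v} X^i`
gives `∑_i (-1)^i q^i e_i(α) X^i = ∏_j (1 - q α_j X)` (by `apply_doubleCosetOperator_heckeDiag`).

## Not in this file

The **Satake isomorphism over `R`** — `𝒮_R` is an isomorphism of `ℋ_R(G, K)` onto the
`S_n`-invariants `R[ℤⁿ]^{S_n} = weylInvariants R (Fin n → ℤ) (glWeylGroup n)` whenever `q ∈ Rˣ`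
(Treumann–Venkatesh (2016), §7.2, Theorem (i) and its proof: the coefficients of the complex
isomorphism shrink to `ℤ[q^{±1/2}]` (Gross (1998), §3; Haines–Rostami) and, after the twist
removing `√q`, to `ℤ[q⁻¹]`) — is *not* stated here (it would be a named fact; over `ℂ` it is the
theorem `SatakeParametersGL.satake_gl_holds` of `SatakeParametersGLIsoProofs`).  With the present
names it reads `Function.Bijective ((satakeTransformModP hϖ hq).codRestrict (weylInvariants R
(Fin n → ℤ) (ConnectedReductiveGroupData.glWeylGroup n)) h)`.  Consequently the *existence* of a
Satake parameter for every character `θ` (for `k` algebraically closed) is not proved here either;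
`IsSatakeParameterModP` is a predicate, unique when it holds (`IsSatakeParameterModP.unique`).

## References

* D. Treumann, A. Venkatesh, *Functoriality, Smith theory, and the Brauer homomorphism*, Ann. of
  Math. 183 (2016), §7.2 (Theorem, (i); the transform `𝒮*`), §7.6 (Satake parameter of a
  character: `h v⁰ = ⟨𝒮* h, θ⟩ v⁰`) — section numbering of arXiv:1407.2346
  [TreumannVenkatesh2016].
* P. Cartier, *Representations of 𝔭-adic groups: a survey*, Proc. Sympos. Pure Math. 33 (1979),
  part 1, §IV.2, (4.2.3), Thm. 4.1 [CartierCorvallis1979].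
* B. H. Gross, *On the Satake isomorphism* (1998), §3 [GrossSatake1998].
* G. Shimura, *Introduction to the arithmetic theory of automorphic functions* (1971), Thm. 3.21
  [ShimuraIATAF1971].
* P. Scholze, *On torsion in the cohomology of locally symmetric varieties*, Ann. of Math. 182
  (2015), Ch. V, §4 [Scholze2015].
* J. Arthur, L. Clozel, *Simple algebras, base change, and the advanced theory of the trace
  formula* (1989), Ch. 3, proof of Thm. 3.1 [ArthurClozelAMS120].
-/

noncomputable section

open scoped Pointwise MatrixGroups
open MulAction ValuativeRel Matrix Finset MonoidAlgebra Representation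
  Literature.LinearAlgebra.Matrix.Echelon

namespace Literature.NumberTheory.Automorphic

variable {F : Type*} [Field F] [ValuativeRel F] {n : ℕ} {R : Type*} [CommRing R]

/-! ### The weight `q^{-⟨ν, e⟩}` as a unit -/

section Weight

/-- The weight `u^{-⟨ν, e⟩} ∈ Rˣ` of the exponent `e ∈ ℤⁿ` for a unit `u` of `R` (applied to
`u = q = #𝓀`): the character `e ↦ q^{-⟨ν, e⟩}`, `ν = (n-1, …, 1, 0)`, of `ℤⁿ` with values in `Rˣ`;
for `R = ℂ` its value is `satakeWeight q e` (`coe_satakeWeightUnit`). [folklore] -/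
def satakeWeightUnit (u : Rˣ) (e : Fin n → ℤ) : Rˣ := u ^ (-satakeTwistExp e)

/-- Multiplicativity of the weight. [folklore] -/
theorem satakeWeightUnit_add (u : Rˣ) (a b : Fin n → ℤ) :
    satakeWeightUnit u (a + b) = satakeWeightUnit u a * satakeWeightUnit u b := by
  rw [satakeWeightUnit, satakeWeightUnit, satakeWeightUnit, satakeTwistExp_add, neg_add, _root_.zpow_add]

/-- The weight of `0` is `1`. [folklore] -/
@[simp]
theorem satakeWeightUnit_zero (u : Rˣ) : satakeWeightUnit u (0 : Fin n → ℤ) = 1 := by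
  rw [satakeWeightUnit, satakeTwistExp_zero, neg_zero, zpow_zero]

/-- Over a field the unit-valued weight is the weight `q^{-⟨ν, e⟩}` computed in the field; for `ℂ`
this is `satakeWeight` of `SatakeTransformGL`. [folklore] -/
theorem coe_satakeWeightUnit {L : Type*} [Field L] (u : Lˣ) (e : Fin n → ℤ) :
    ((satakeWeightUnit u e : Lˣ) : L) = (u : L) ^ (-satakeTwistExp e) := by
  rw [satakeWeightUnit, Units.val_zpow_eq_zpow_val]

/-- `satakeWeightUnit u e = satakeWeight u e` in `ℂ`. [folklore] -/
theorem coe_satakeWeightUnit_eq_satakeWeight (u : ℂˣ) (e : Fin n → ℤ) :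
    ((satakeWeightUnit u e : ℂˣ) : ℂ) = satakeWeight (u : ℂ) e :=
  coe_satakeWeightUnit u e

end Weight

/-! ### The transform with coefficients in `R` -/

section Transform

variable [IsDiscreteValuationRing 𝒪[F]] {ϖ : F} (hϖ : IsUniformizingElement ϖ)
  (hq : IsUnit ((Nat.card 𝓀[F] : ℕ) : R))

include hϖ hq in
/-- The **Satake transform on vectors** with coefficients in `R`: the `R`-linear map
`R[G ⧸ K] → R[ℤⁿ]`, `[γ] ↦ q^{-⟨ν, e(γ)⟩} x^{e(γ)}`, `e(γ)` the Iwasawa exponent of the coset `γ`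
and `q^{-1} = hq.unit⁻¹`. [folklore] -/
def satakeVecModP :
    MonoidAlgebra R (GL (Fin n) F ⧸ glInt n F) →ₗ[R] AddMonoidAlgebra R (Fin n → ℤ) :=
  Finsupp.linearCombination R (fun γ : GL (Fin n) F ⧸ glInt n F =>
      AddMonoidAlgebra.single (iwasawaExp hϖ γ.out)
        ((satakeWeightUnit hq.unit (iwasawaExp hϖ γ.out) : Rˣ) : R)) ∘ₗ
    (MonoidAlgebra.coeffLinearEquiv R).toLinearMap

/-- `satakeVecModP` on a basis vector `[γ]`. [folklore] -/
theorem satakeVecModP_single (γ : GL (Fin n) F ⧸ glInt n F) (c : R) :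
    satakeVecModP hϖ hq (single γ c) = AddMonoidAlgebra.single (iwasawaExp hϖ γ.out)
      (c * satakeWeightUnit hq.unit (iwasawaExp hϖ γ.out)) := by
  simp [satakeVecModP, Finsupp.linearCombination_single]

/-- `satakeVecModP` on `[gK]` for `g ∈ G`. [folklore] -/
theorem satakeVecModP_single_coe (g : GL (Fin n) F) (c : R) :
    satakeVecModP hϖ hq (single (g : GL (Fin n) F ⧸ glInt n F) c) =
      AddMonoidAlgebra.single (iwasawaExp hϖ g)
        (c * satakeWeightUnit hq.unit (iwasawaExp hϖ g)) := by
  rw [satakeVecModP_single, iwasawaExp_out_coe]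

/-- `satakeVecModP` as a sum over the support. [folklore] -/
theorem satakeVecModP_apply (x : MonoidAlgebra R (GL (Fin n) F ⧸ glInt n F)) :
    satakeVecModP hϖ hq x = ∑ γ ∈ x.coeff.support, x.coeff γ • AddMonoidAlgebra.single
      (iwasawaExp hϖ γ.out) ((satakeWeightUnit hq.unit (iwasawaExp hϖ γ.out) : Rˣ) : R) := by
  simp [satakeVecModP, Finsupp.linearCombination_apply, Finsupp.sum]

/-- The transform of `[K]` is `1`. [folklore] -/
theorem satakeVecModP_single_one :
    satakeVecModP hϖ hq (single ((1 : GL (Fin n) F) : GL (Fin n) F ⧸ glInt n F) 1) = 1 := by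
  rw [satakeVecModP_single_coe, iwasawaExp_one, satakeWeightUnit_zero, Units.val_one, one_mul,
    AddMonoidAlgebra.one_def]

/-- **Translation by a Borel element multiplies by a monomial**: for `b = u ϖ^m` (`u ∈ U`) and
every `x ∈ R[G ⧸ K]`, `satakeVecModP (π(b) x) = q^{-⟨ν, m⟩} x^m · satakeVecModP x`. [folklore] -/
theorem satakeVecModP_ofMulAction_unipotent_mul_zpowDiagGL {u : GL (Fin n) F}
    (hu : u ∈ upperUnitriangular (Fin n) F) (m : Fin n → ℤ)
    (x : MonoidAlgebra R (GL (Fin n) F ⧸ glInt n F)) :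
    satakeVecModP hϖ hq (ofMulAction R (GL (Fin n) F) (GL (Fin n) F ⧸ glInt n F)
        (u * zpowDiagGL hϖ.ne_zero m) x) =
      AddMonoidAlgebra.single m ((satakeWeightUnit hq.unit m : Rˣ) : R) *
        satakeVecModP hϖ hq x := by
  suffices h : satakeVecModP hϖ hq ∘ₗ ofMulAction R (GL (Fin n) F) (GL (Fin n) F ⧸ glInt n F)
        (u * zpowDiagGL hϖ.ne_zero m) =
      LinearMap.mulLeft R (AddMonoidAlgebra.single m ((satakeWeightUnit hq.unit m : Rˣ) : R)) ∘ₗ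
        satakeVecModP hϖ hq from LinearMap.congr_fun h x
  refine MonoidAlgebra.lhom_ext' fun γ => LinearMap.ext fun c => ?_
  induction γ using QuotientGroup.induction_on with
  | H g =>
    simp only [LinearMap.comp_apply, MonoidAlgebra.lsingle_apply, ofMulAction_single,
      LinearMap.mulLeft_apply, MulAction.Quotient.smul_coe, smul_eq_mul, satakeVecModP_single_coe,
      iwasawaExp_unipotent_mul_zpowDiagGL_mul hϖ hu, AddMonoidAlgebra.single_mul_single]
    rw [satakeWeightUnit_add, Units.val_mul]
    congr 1
    ring

/-- **Translation by a representative**: `satakeVecModP (π(γ̃) s) = q^{-⟨ν, e(γ)⟩} x^{e(γ)} ·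
satakeVecModP s` for a `K`-invariant `s`. [folklore] -/
theorem satakeVecModP_ofMulAction_out {s : MonoidAlgebra R (GL (Fin n) F ⧸ glInt n F)}
    (hs : ∀ a ∈ glInt n F, ofMulAction R (GL (Fin n) F) (GL (Fin n) F ⧸ glInt n F) a s = s)
    (γ : GL (Fin n) F ⧸ glInt n F) :
    satakeVecModP hϖ hq (ofMulAction R (GL (Fin n) F) (GL (Fin n) F ⧸ glInt n F) γ.out s) =
      AddMonoidAlgebra.single (iwasawaExp hϖ γ.out)
        ((satakeWeightUnit hq.unit (iwasawaExp hϖ γ.out) : Rˣ) : R) * satakeVecModP hϖ hq s := by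
  obtain ⟨u, hu, k, hk, h⟩ := iwasawaExp_spec hϖ γ.out
  set m := iwasawaExp hϖ γ.out
  conv_lhs => rw [h, map_mul, Module.End.mul_apply, hs k hk]
  exact satakeVecModP_ofMulAction_unipotent_mul_zpowDiagGL hϖ hq hu m s

/-- **The Satake transform with coefficients in `R`** (`q = #𝓀` a unit in `R`, e.g. `R` a field of
characteristic `p ∤ q` — "mod `p`" —, `ℤ[q⁻¹]`, or `ℂ`):
`𝒮_R : ℋ_R(GL_n(F), GL_n(𝒪)) →ₐ[R] R[ℤⁿ]`,
`𝒮_R(T) = ∑_{γ ∈ G/K} (T [K])(γ) q^{-⟨ν, e(γ)⟩} x^{e(γ)}`, `ν = (n-1, …, 1, 0)`, `e(γ)` the Iwasawa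
exponent — the integral normalisation `|det|^{(n-1)/2} δ^{1/2} ∫_U` of Cartier's
`(Sf)(t) = δ(t)^{1/2} ∫_U f(tu) du` (Corvallis 1979, §IV.2, (4.2.3)), equivalently
`q^{-⟨ν, ·⟩}` times Treumann–Venkatesh's square-root-free `𝒮*(f)(t) = ∫_U f(tu) du` ((2016), §7.2);
for `R = ℂ` it is `satakeTransform hϖ` of `SatakeTransformGL` (`satakeTransformModP_complex`).  An
algebra homomorphism: unital by `satakeVecModP_single_one`, multiplicative because
`(S T) [K] = ∑_γ (T [K])(γ) π(γ̃) (S [K])` (`heckeAlgebra.toVector_mul_eq_sum`) and translation by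
the Borel part of `γ̃` multiplies the transform by the monomial of `γ`
(`satakeVecModP_ofMulAction_out`; Cartier, op. cit., proof of Thm. 4.1, step (a)).
[cite: TreumannVenkatesh2016, §7.2] -/
def satakeTransformModP :
    heckeAlgebra R (GL (Fin n) F) (glInt n F) →ₐ[R] AddMonoidAlgebra R (Fin n → ℤ) :=
  AlgHom.ofLinearMap (satakeVecModP hϖ hq ∘ₗ heckeAlgebra.toVector (glInt n F))
    (by rw [LinearMap.comp_apply, heckeAlgebra.toVector_one, satakeVecModP_single_one])
    (by
      intro S T
      simp only [LinearMap.comp_apply]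
      rw [heckeAlgebra.toVector_mul_eq_sum, map_sum, mul_comm, satakeVecModP_apply hϖ hq
        (heckeAlgebra.toVector (glInt n F) T), Finset.sum_mul]
      refine Finset.sum_congr rfl fun γ _ => ?_
      rw [map_smul, satakeVecModP_ofMulAction_out hϖ hq
        (fun a ha => heckeAlgebra.ofMulAction_toVector (glInt n F) S ha), smul_mul_assoc])

/-- Unfolding lemma: `𝒮_R(T) = satakeVecModP (T [K])`. [folklore] -/
theorem satakeTransformModP_apply (T : heckeAlgebra R (GL (Fin n) F) (glInt n F)) :
    satakeTransformModP hϖ hq T = satakeVecModP hϖ hq (heckeAlgebra.toVector (glInt n F) T) :=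
  rfl

section DoubleCoset

variable [IsHeckeTriple (⊤ : Submonoid (GL (Fin n) F)) (glInt n F) (glInt n F)]

/-- `𝒮_R(T_g) = ∑_{α ∈ KgK/K} q^{-⟨ν, e(α)⟩} x^{e(α)}`. [folklore] -/
theorem satakeTransformModP_doubleCosetOperator (g : GL (Fin n) F) :
    satakeTransformModP hϖ hq (heckeAlgebra.doubleCosetOperator (glInt n F) g) =
      ∑ α ∈ (finite_orbit_quotient (glInt n F) g).toFinset,
        AddMonoidAlgebra.single (iwasawaExp hϖ α.out)
          ((satakeWeightUnit hq.unit (iwasawaExp hϖ α.out) : Rˣ) : R) := by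
  rw [satakeTransformModP_apply, heckeAlgebra.toVector_doubleCosetOperator,
    heckeAlgebra.doubleCosetIndicator_eq_sum, map_sum]
  refine Finset.sum_congr rfl fun α _ => ?_
  rw [satakeVecModP_single, one_mul]

end DoubleCoset

end Transform

/-! ### Comparison with the transform over `ℂ` -/

section Complex

/-- `q = #𝓀` is a unit of `ℂ` (finite residue field). [folklore] -/
theorem isUnit_natCard_residueField_complex [Finite 𝓀[F]] : IsUnit ((Nat.card 𝓀[F] : ℕ) : ℂ) :=
  isUnit_iff_ne_zero.2 natCard_residueField_ne_zero

variable [IsDiscreteValuationRing 𝒪[F]] {ϖ : F} (hϖ : IsUniformizingElement ϖ)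

/-- Over `ℂ` the vector transform is `satakeVec` of `SatakeTransformGL`. [folklore] -/
theorem satakeVecModP_complex (hq : IsUnit ((Nat.card 𝓀[F] : ℕ) : ℂ)) :
    satakeVecModP (n := n) hϖ hq = satakeVec hϖ := by
  refine MonoidAlgebra.lhom_ext' fun γ => LinearMap.ext fun c => ?_
  simp only [LinearMap.comp_apply, MonoidAlgebra.lsingle_apply, satakeVecModP_single,
    satakeVec_single, coe_satakeWeightUnit_eq_satakeWeight, IsUnit.unit_spec]

/-- **The transform over `ℂ` is the Satake transform of `SatakeTransformGL`**:
`satakeTransformModP hϖ hq = satakeTransform hϖ` for `R = ℂ` (so `hq` may be taken to be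
`isUnit_natCard_residueField_complex`). [folklore] -/
theorem satakeTransformModP_complex [Finite 𝓀[F]] (hq : IsUnit ((Nat.card 𝓀[F] : ℕ) : ℂ)) :
    satakeTransformModP (n := n) hϖ hq = satakeTransform hϖ := by
  refine AlgHom.ext fun T => ?_
  rw [satakeTransformModP_apply, satakeTransform_apply, satakeVecModP_complex]

end Complex

/-! ### The transform of `T_r` -/

section HeckeDiag

variable [IsDiscreteValuationRing 𝒪[F]] [Finite 𝓀[F]] {ϖ : F} (hϖ : IsUniformizingElement ϖ)
  (hq : IsUnit ((Nat.card 𝓀[F] : ℕ) : R))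
  [IsHeckeTriple (⊤ : Submonoid (GL (Fin n) F)) (glInt n F) (glInt n F)]

/-- **The transform of `T_r` with coefficients in `R`** (`r ≤ n`, `T_r = T_{diag(ϖ 1_r, 1_{n-r})}`):
`𝒮_R(T_r) = q^{-r(r-1)/2} ∑_{#t = r} x^{𝟙_t} = q^{-r(r-1)/2} e_r(x)`, the `r`-th elementary
symmetric polynomial, `q^{-1} = hq.unit⁻¹` — the same computation as over `ℂ`
(`satakeTransform_doubleCosetOperator_heckeDiag`: the transversal `u_a ϖ^{ε_S}` of `K t_r K / K`,
`#S = n - r`, `q^{c(S)}` tables `ā`, `e(u_a ϖ^{ε_S}) = ε_S = 𝟙_{Sᶜ}` and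
`c(S) - ⟨ν, ε_S⟩ = -r(r-1)/2`), valid in any coefficient ring since only the unit `q` is inverted
(Tamagawa; Shimura (1971), Thm. 3.21; Cartier, Corvallis 1979, §IV.2, Example).
[cite: ShimuraIATAF1971, Thm. 3.21] -/
theorem satakeTransformModP_doubleCosetOperator_heckeDiag {r : ℕ} (hr : r ≤ n) :
    satakeTransformModP hϖ hq (heckeAlgebra.doubleCosetOperator (glInt n F)
        (heckeDiag n (Units.mk0 ϖ hϖ.ne_zero) r)) =
      ((hq.unit⁻¹ ^ (r * (r - 1) / 2) : Rˣ) : R) •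
        ∑ t ∈ Finset.powersetCard r (univ : Finset (Fin n)),
          AddMonoidAlgebra.single (fun i => if i ∈ t then (1 : ℤ) else 0) (1 : R) := by
  classical
  haveI : Fintype 𝓀[F] := Fintype.ofFinite _
  have hqcard : (Fintype.card 𝓀[F] : R) = ((Nat.card 𝓀[F] : ℕ) : R) := by
    rw [Nat.card_eq_fintype_card]
  -- Step 1: the sum over the orbit is a sum over the transversal `{u_a ϖ^{ε_S}}`
  have hbij := bijOn_heckeTransversal (n := n) hϖ hr
  rw [satakeTransformModP_doubleCosetOperator]
  have himg : (finite_orbit_quotient (glInt n F) (heckeDiag n (Units.mk0 ϖ hϖ.ne_zero) r)).toFinset =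
      (heckeTransversal (n := n) hϖ.ne_zero r).image
        (fun y : GL (Fin n) F => (y : GL (Fin n) F ⧸ glInt n F)) := by
    ext γ
    rw [Set.Finite.mem_toFinset, Finset.mem_image]
    constructor
    · intro hγ
      obtain ⟨y, hy, rfl⟩ := hbij.surjOn hγ
      exact ⟨y, hy, rfl⟩
    · rintro ⟨y, hy, rfl⟩
      exact hbij.mapsTo hy
  rw [himg, Finset.sum_image fun x hx y hy h => hbij.injOn hx hy h, sum_heckeTransversal hϖ]
  -- Step 2: the exponent of a representative is `ε_S`
  have hrep : ∀ p : TransversalIndex n F r,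
      iwasawaExp hϖ ((p.rep hϖ.ne_zero : GL (Fin n) F ⧸ glInt n F).out) =
        fun i => (epsOf p.1.1 i : ℤ) := by
    rintro ⟨⟨S, ā⟩, hS, h⟩
    rw [iwasawaExp_out_coe]
    change iwasawaExp hϖ (heckeRep hϖ.ne_zero h) = _
    rw [heckeRep_eq_mul, iwasawaExp_unipotent_mul_piPowGL hϖ (echelonGL_mem_upperUnitriangular h)]
  simp_rw [hrep]
  -- Step 3: count the tables with a given pivot set
  rw [sum_transversalIndex_of_fst r (fun S : Finset (Fin n) =>
    AddMonoidAlgebra.single (fun i => (epsOf S i : ℤ))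
      ((satakeWeightUnit hq.unit (fun i => (epsOf S i : ℤ)) : Rˣ) : R))]
  -- Step 4: reindex `S ↦ univ \ S` and evaluate the weights
  rw [Finset.smul_sum]
  refine Finset.sum_nbij' (fun S => univ \ S) (fun t => univ \ t) ?_ ?_ ?_ ?_ ?_
  · intro S hS
    rw [Finset.mem_filter] at hS
    rw [Finset.mem_powersetCard, Finset.card_sdiff_of_subset (subset_univ S),
      Finset.card_univ, Fintype.card_fin, hS.2]
    exact ⟨Finset.sdiff_subset, by omega⟩
  · intro t ht
    rw [Finset.mem_powersetCard] at ht
    rw [Finset.mem_filter, Finset.card_sdiff_of_subset (subset_univ t),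
      Finset.card_univ, Fintype.card_fin, ht.2]
    exact ⟨Finset.mem_univ _, by omega⟩
  · intro S _
    rw [sdiff_sdiff_right_self, Finset.inf_eq_inter, Finset.univ_inter]
  · intro t _
    rw [sdiff_sdiff_right_self, Finset.inf_eq_inter, Finset.univ_inter]
  · intro S hS
    rw [Finset.mem_filter] at hS
    have heps : (fun i => (epsOf S i : ℤ)) = fun i => if i ∈ univ \ S then (1 : ℤ) else 0 := by
      funext i
      simp only [epsOf, Finset.mem_sdiff, Finset.mem_univ, true_and]
      split_ifs <;> simp
    rw [heps, ← Nat.cast_smul_eq_nsmul R, Nat.cast_pow, hqcard, AddMonoidAlgebra.smul_single,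
      AddMonoidAlgebra.smul_single, smul_eq_mul, smul_eq_mul, mul_one]
    congr 1
    -- the weight: `q^{c(S)} q^{-⟨ν, ε_S⟩} = q^{-r(r-1)/2}`
    have hexp : satakeTwistExp (fun i => if i ∈ univ \ S then (1 : ℤ) else 0) =
        ∑ i ∈ univ \ S, ((n : ℤ) - 1 - (i : ℕ)) := by
      rw [satakeTwistExp, ← Finset.sum_filter_add_sum_filter_not univ (fun i => i ∈ univ \ S)]
      rw [Finset.sum_eq_zero (s := univ.filter fun i => ¬ i ∈ univ \ S) (fun i hi => by
        rw [Finset.mem_filter] at hi; rw [if_neg hi.2, mul_zero]), add_zero]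
      have : univ.filter (fun i : Fin n => i ∈ univ \ S) = univ \ S := by
        ext i; simp
      rw [this]
      exact Finset.sum_congr rfl fun i hi => by rw [if_pos hi, mul_one]
    have hqu : ((Nat.card 𝓀[F] : ℕ) : R) ^ (echelonPositions S).card =
        ((hq.unit ^ ((echelonPositions S).card : ℤ) : Rˣ) : R) := by
      rw [zpow_natCast, Units.val_pow_eq_pow_val, IsUnit.unit_spec]
    rw [satakeWeightUnit, hexp, hqu, ← Units.val_mul, ← _root_.zpow_add, ← sub_eq_add_neg,
      card_echelonPositions_sub_sum S hr hS.2, _root_.zpow_neg, zpow_natCast, inv_pow]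

end HeckeDiag

/-! ### Evaluation of Laurent polynomials at a point of `(kˣ)ⁿ` (field coefficients) -/

section Eval

variable {k : Type*} [Field k]

/-- `laurentEval a (x^{𝟙_t}) = ∏_{i ∈ t} a_i` for the evaluation map `laurentEval a : k[ℤⁿ] → k`
of `TorusCharacters`. [folklore] -/
theorem laurentEval_single_indicator (a : Fin n → kˣ) (t : Finset (Fin n)) :
    laurentEval a (AddMonoidAlgebra.single (fun i => if i ∈ t then (1 : ℤ) else 0) 1) =
      ∏ i ∈ t, (a i : k) := by
  rw [laurentEval_single, one_mul, ← Units.coe_prod]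
  congr 1
  rw [← Finset.prod_filter_mul_prod_filter_not univ (fun i => i ∈ t)]
  have h1 : univ.filter (fun i : Fin n => i ∈ t) = t := by ext i; simp
  rw [h1, Finset.prod_eq_one (s := univ.filter fun i : Fin n => ¬ i ∈ t) (fun i hi => by
      rw [Finset.mem_filter] at hi; rw [if_neg hi.2, zpow_zero]), mul_one]
  exact Finset.prod_congr rfl fun i hi => by rw [if_pos hi, zpow_one]

/-- `laurentEval a (e_r(x)) = e_r(a)`: the elementary symmetric Laurent polynomial evaluates to the
elementary symmetric function of the multiset `{a_1, …, a_n}`. [folklore] -/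
theorem laurentEval_sum_powersetCard (a : Fin n → kˣ) (r : ℕ) :
    laurentEval a (∑ t ∈ Finset.powersetCard r (univ : Finset (Fin n)),
        AddMonoidAlgebra.single (fun i => if i ∈ t then (1 : ℤ) else 0) (1 : k)) =
      ((univ : Finset (Fin n)).val.map fun i => (a i : k)).esymm r := by
  rw [map_sum, Finset.esymm_map_val]
  exact Finset.sum_congr rfl fun t _ => laurentEval_single_indicator a t

end Eval

/-! ### Satake parameters of a character of `ℋ_k(GL_n(F), GL_n(𝒪))` -/

section Parameter

variable {k : Type*} [Field k]
variable [IsDiscreteValuationRing 𝒪[F]] {ϖ : F} (hϖ : IsUniformizingElement ϖ)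
  (hq : IsUnit ((Nat.card 𝓀[F] : ℕ) : k))

include hϖ hq in
/-- The character `θ : ℋ_k(GL_n(F), GL_n(𝒪)) → k` (`k` a field in which `q ≠ 0`) **has Satake
parameter** `α`, a multiset of `n` units of `k` (with respect to the uniformizer `ϖ` and the
integral normalisation `q^{-⟨ν, e⟩}` of `satakeTransformModP`): `θ` is the Satake transform
followed by evaluation (`laurentEval` of `TorusCharacters`) at a point `a ∈ (kˣ)ⁿ` with
`{a_1, …, a_n} = α`, i.e. `θ(T) = 𝒮_k(T)(a)` — the pull-back along the Satake transform of the
character `x^e ↦ a^e` of `k[ℤⁿ] = k[T/T(𝒪)]`, which for the character of `ℋ` on the spherical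
line of the unramified principal series of an unramified `k`-valued character of the torus is that
character (Treumann–Venkatesh (2016), §7.6, the displayed formula `h v⁰ = ⟨𝒮* h, θ⟩ v⁰`, there
for `𝒮* = δ^{-1/2} 𝒮`; Cartier, Corvallis 1979, §IV.3–IV.4 over `ℂ`).  The multiset only depends
on the `S_n`-orbit of `a`; it is unique (`IsSatakeParameterModP.unique`), and
`θ(T_r) = q^{-r(r-1)/2} e_r(α)` (`IsSatakeParameterModP.apply_doubleCosetOperator_heckeDiag`).
[cite: TreumannVenkatesh2016, §7.6] -/
def IsSatakeParameterModP (θ : heckeAlgebra k (GL (Fin n) F) (glInt n F) →ₐ[k] k)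
    (α : Multiset kˣ) : Prop :=
  ∃ a : Fin n → kˣ, (univ : Finset (Fin n)).val.map a = α ∧
    θ = (laurentEval a).comp (satakeTransformModP hϖ hq)

/-- The character `T ↦ 𝒮_k(T)(a)` has Satake parameter `{a_1, …, a_n}`. [folklore] -/
theorem isSatakeParameterModP_comp (a : Fin n → kˣ) :
    IsSatakeParameterModP hϖ hq ((laurentEval a).comp (satakeTransformModP hϖ hq))
      ((univ : Finset (Fin n)).val.map a) :=
  ⟨a, rfl, rfl⟩

namespace IsSatakeParameterModP

variable {hϖ hq}
variable {θ : heckeAlgebra k (GL (Fin n) F) (glInt n F) →ₐ[k] k} {α : Multiset kˣ}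

/-- A Satake parameter has `n` elements. [folklore] -/
theorem card_eq (h : IsSatakeParameterModP hϖ hq θ α) : Multiset.card α = n := by
  obtain ⟨a, rfl, -⟩ := h
  rw [Multiset.card_map, Finset.card_val, Finset.card_univ, Fintype.card_fin]

variable [Finite 𝓀[F]] [IsHeckeTriple (⊤ : Submonoid (GL (Fin n) F)) (glInt n F) (glInt n F)]

/-- **Hecke eigenvalues from the parameter**: `θ(T_r) = q^{-r(r-1)/2} e_r(α)` for `r ≤ n`
(`satakeTransformModP_doubleCosetOperator_heckeDiag`). [folklore] -/
theorem apply_doubleCosetOperator_heckeDiag (h : IsSatakeParameterModP hϖ hq θ α) {r : ℕ}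
    (hr : r ≤ n) :
    θ (heckeAlgebra.doubleCosetOperator (glInt n F) (heckeDiag n (Units.mk0 ϖ hϖ.ne_zero) r)) =
      ((hq.unit⁻¹ ^ (r * (r - 1) / 2) : kˣ) : k) * (α.map (Units.val : kˣ → k)).esymm r := by
  obtain ⟨a, rfl, rfl⟩ := h
  rw [AlgHom.comp_apply, satakeTransformModP_doubleCosetOperator_heckeDiag hϖ hq hr, map_smul,
    laurentEval_sum_powersetCard, smul_eq_mul, Multiset.map_map]
  rfl

open Polynomial in
omit [IsDiscreteValuationRing 𝒪[F]] [Finite 𝓀[F]]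
  [IsHeckeTriple (⊤ : Submonoid (GL (Fin n) F)) (glInt n F) (glInt n F)] in
/-- **Vieta, injectivity** (private copy of `Multiset.eq_of_esymm_eq` of `SatakeParametersGLProofs`,
not imported to keep this file light): two multisets of the same cardinality over an integral
domain with the same elementary symmetric functions are equal — both are the roots of
`∏ (X - a)`. [folklore] -/
private theorem multiset_eq_of_esymm_eq {S : Type*} [CommRing S] [IsDomain S] {s t : Multiset S}
    (hcard : Multiset.card s = Multiset.card t)
    (h : ∀ i ≤ Multiset.card s, s.esymm i = t.esymm i) : s = t := by
  have hp : (s.map fun a => X - C a).prod = (t.map fun a => X - C a).prod := by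
    refine Polynomial.ext fun j => ?_
    by_cases hj : j ≤ Multiset.card s
    · rw [Multiset.prod_X_sub_C_coeff s hj, Multiset.prod_X_sub_C_coeff t (hcard ▸ hj), ← hcard,
        h _ (Nat.sub_le _ _)]
    · push Not at hj
      rw [coeff_eq_zero_of_natDegree_lt, coeff_eq_zero_of_natDegree_lt] <;>
        rw [natDegree_multiset_prod_X_sub_C_eq_card]
      · rwa [← hcard]
      · exact hj
  rw [← Polynomial.roots_multiset_prod_X_sub_C s, hp, Polynomial.roots_multiset_prod_X_sub_C]

/-- **Uniqueness of the Satake parameter** of a character: the eigenvalues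
`θ(T_r) = q^{-r(r-1)/2} e_r(α)`, `r ≤ n`, determine `e_1(α), …, e_n(α)`, hence `α` (Vieta).
[folklore] -/
theorem unique {β : Multiset kˣ} (hα : IsSatakeParameterModP hϖ hq θ α)
    (hβ : IsSatakeParameterModP hϖ hq θ β) : α = β := by
  apply Multiset.map_injective Units.val_injective
  have hca : Multiset.card (α.map (Units.val : kˣ → k)) = n := by rw [Multiset.card_map, hα.card_eq]
  have hcb : Multiset.card (β.map (Units.val : kˣ → k)) = n := by rw [Multiset.card_map, hβ.card_eq]
  refine multiset_eq_of_esymm_eq (hca.trans hcb.symm) fun i hi => ?_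
  rw [hca] at hi
  have h1 := hα.apply_doubleCosetOperator_heckeDiag hi
  rw [hβ.apply_doubleCosetOperator_heckeDiag hi] at h1
  exact ((Units.mul_right_inj _).1 h1).symm

end IsSatakeParameterModP

end Parameter

/-! ### Unramified twists

The twist of the spherical Hecke algebra by the unramified character `g ↦ c^{v(det g)}` of
`GL_n(F)` (`c ∈ Rˣ`): the algebra automorphism `T_g ↦ c^{v(det g)} T_g`, under which the Satake
transform is twisted by `x_i ↦ c x_i` and Satake parameters are multiplied by `c`. -/

section DetExp

variable [IsDiscreteValuationRing 𝒪[F]] {ϖ : F} (hϖ : IsUniformizingElement ϖ)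

/-- `∏_{i ∈ s} a ^ {f i} = a ^ {∑_{i ∈ s} f i}` for integer exponents in a commutative group with
zero, `a ≠ 0`. [folklore] -/
private theorem prod_zpow_eq_zpow_sum₀ {G ι : Type*} [CommGroupWithZero G] {a : G} (ha : a ≠ 0)
    (s : Finset ι) (f : ι → ℤ) : ∏ i ∈ s, a ^ f i = a ^ (∑ i ∈ s, f i) := by
  classical
  induction s using Finset.induction_on with
  | empty => rw [Finset.prod_empty, Finset.sum_empty, zpow_zero]
  | insert i s hi ih => rw [Finset.prod_insert hi, Finset.sum_insert hi, ih, zpow_add₀ ha]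

/-- `∏_{i ∈ s} a ^ {f i} = a ^ {∑_{i ∈ s} f i}` for integer exponents in a commutative group.
[folklore] -/
private theorem prod_zpow_eq_zpow_sum' {G ι : Type*} [CommGroup G] (a : G)
    (s : Finset ι) (f : ι → ℤ) : ∏ i ∈ s, a ^ f i = a ^ (∑ i ∈ s, f i) := by
  classical
  induction s using Finset.induction_on with
  | empty => rw [Finset.prod_empty, Finset.sum_empty, zpow_zero]
  | insert i s hi ih => rw [Finset.prod_insert hi, Finset.sum_insert hi, ih, _root_.zpow_add]

include hϖ in
/-- The **determinant exponent** `v(det g) ∈ ℤ` of `g ∈ GL_n(F)`, defined as the total degree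
`∑ i, e(g)_i` of the Iwasawa exponent (`valuation_det_eq_zpow_detExp`: `|det g| = |ϖ|^{v(det g)}`).
[folklore] -/
def detExp (g : GL (Fin n) F) : ℤ := ∑ i, iwasawaExp hϖ g i

/-- `v(det (g k)) = v(det g)` for `k ∈ K`. [folklore] -/
theorem detExp_mul_of_mem_glInt (g : GL (Fin n) F) {k : GL (Fin n) F} (hk : k ∈ glInt n F) :
    detExp hϖ (g * k) = detExp hϖ g := by
  simp only [detExp, iwasawaExp_mul_of_mem_glInt hϖ g hk]

/-- `v(det (gK)~) = v(det g)`. [folklore] -/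
theorem detExp_out_coe (g : GL (Fin n) F) :
    detExp hϖ ((g : GL (Fin n) F ⧸ glInt n F).out) = detExp hϖ g := by
  simp only [detExp, iwasawaExp_out_coe]

/-- `v(det 1) = 0`. [folklore] -/
theorem detExp_one : detExp hϖ (1 : GL (Fin n) F) = 0 := by
  simp [detExp, iwasawaExp_one]

/-- `v(det k) = 0` for `k ∈ K`. [folklore] -/
theorem detExp_of_mem_glInt {k : GL (Fin n) F} (hk : k ∈ glInt n F) : detExp hϖ k = 0 := by
  simp [detExp, iwasawaExp_of_mem_glInt hϖ hk]

/-- **`|det g| = |ϖ|^{v(det g)}`**: from `g = u ϖ^{e(g)} k`, `det u = 1`, `|det k| = 1`. [folklore] -/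
theorem valuation_det_eq_zpow_detExp (g : GL (Fin n) F) :
    valuation F ((g : GL (Fin n) F) : Matrix (Fin n) (Fin n) F).det =
      valuation F ϖ ^ detExp hϖ g := by
  obtain ⟨u, hu, k, hk, h⟩ := iwasawaExp_spec hϖ g
  -- `det u = 1` (`det_eq_one_of_mem_upperUnitriangular` of `RankinSelbergLocal`, in `GL_n`)
  have hdu : ((u : GL (Fin n) F) : Matrix (Fin n) (Fin n) F).det = 1 := by
    rw [← Matrix.GeneralLinearGroup.val_det_apply, det_eq_one_of_mem_upperUnitriangular hu,
      Units.val_one]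
  conv_lhs => rw [h]
  rw [Units.val_mul, Units.val_mul, Matrix.det_mul, Matrix.det_mul, map_mul, map_mul,
    valuation_det_eq_one_of_mem_glInt hk, mul_one, hdu, map_one, one_mul, coe_zpowDiagGL,
    Matrix.det_diagonal, prod_zpow_eq_zpow_sum₀ hϖ.ne_zero, map_zpow₀]
  rfl

include hϖ in
omit [IsDiscreteValuationRing 𝒪[F]] in
/-- `|ϖ|^a = |ϖ|^b` forces `a = b` (`ϖ` is not a unit). [folklore] -/
theorem zpow_valuation_injective {a b : ℤ} (h : valuation F ϖ ^ a = valuation F ϖ ^ b) : a = b := by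
  have hv0 : valuation F ϖ ≠ 0 := (Valuation.ne_zero_iff _).2 hϖ.ne_zero
  have key : ∀ d : ℤ, valuation F ϖ ^ d = 1 → ϖ ^ d ∈ 𝒪[F] := fun d hd => by
    rw [Valuation.mem_integer_iff, map_zpow₀, hd]
  have h1 : valuation F ϖ ^ (a - b) = 1 := by
    rw [zpow_sub₀ hv0, h, div_self (zpow_ne_zero _ hv0)]
  have h2 : valuation F ϖ ^ (-(a - b)) = 1 := by rw [_root_.zpow_neg, h1, inv_one]
  have := hϖ.eq_zero_of_zpow_mem (key _ h1) (key _ h2)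
  omega

/-- **Additivity**: `v(det (g h)) = v(det g) + v(det h)`. [folklore] -/
theorem detExp_mul (g h : GL (Fin n) F) : detExp hϖ (g * h) = detExp hϖ g + detExp hϖ h := by
  have hv0 : valuation F ϖ ≠ 0 := (Valuation.ne_zero_iff _).2 hϖ.ne_zero
  refine zpow_valuation_injective hϖ ?_
  rw [zpow_add₀ hv0, ← valuation_det_eq_zpow_detExp, ← valuation_det_eq_zpow_detExp,
    ← valuation_det_eq_zpow_detExp, Units.val_mul, Matrix.det_mul, map_mul]

/-- `v(det (k g)) = v(det g)` for `k ∈ K`. [folklore] -/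
theorem detExp_glInt_mul {k : GL (Fin n) F} (hk : k ∈ glInt n F) (g : GL (Fin n) F) :
    detExp hϖ (k * g) = detExp hϖ g := by
  rw [detExp_mul, detExp_of_mem_glInt hϖ hk, zero_add]

/-- `v(det γ̃)` is constant on the double coset: `v(det (a • gK)~) = v(det g)` for `a ∈ K`.
[folklore] -/
theorem detExp_out_of_mem_orbit {g : GL (Fin n) F} {γ : GL (Fin n) F ⧸ glInt n F}
    (hγ : γ ∈ MulAction.orbit (glInt n F) (g : GL (Fin n) F ⧸ glInt n F)) :
    detExp hϖ γ.out = detExp hϖ g := by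
  obtain ⟨a, rfl⟩ := MulAction.mem_orbit_iff.1 hγ
  rw [show (a • (g : GL (Fin n) F ⧸ glInt n F)) = ((a : GL (Fin n) F) * g : GL (Fin n) F) from rfl,
    detExp_out_coe, detExp_glInt_mul hϖ a.2]

end DetExp

section Twist

variable [IsDiscreteValuationRing 𝒪[F]] {ϖ : F} (hϖ : IsUniformizingElement ϖ)

/-! #### The twist `[γ] ↦ c^{v(det γ)} [γ]` of `R[G ⧸ K]` -/

include hϖ in
/-- Multiplication by the unramified character `c^{v(det)}` on `R[G ⧸ K]`:
`[γ] ↦ c^{v(det γ)} [γ]`. [folklore] -/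
def detTwistVec (c : Rˣ) :
    MonoidAlgebra R (GL (Fin n) F ⧸ glInt n F) →ₗ[R] MonoidAlgebra R (GL (Fin n) F ⧸ glInt n F) :=
  Finsupp.linearCombination R (fun γ : GL (Fin n) F ⧸ glInt n F =>
      single γ ((c ^ detExp hϖ γ.out : Rˣ) : R)) ∘ₗ
    (MonoidAlgebra.coeffLinearEquiv R).toLinearMap

/-- `detTwistVec c [γ] = c^{v(det γ)} [γ]`. [folklore] -/
theorem detTwistVec_single (c : Rˣ) (γ : GL (Fin n) F ⧸ glInt n F) (r : R) :
    detTwistVec hϖ c (single γ r) = single γ (r * ((c ^ detExp hϖ γ.out : Rˣ) : R)) := by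
  simp [detTwistVec, Finsupp.linearCombination_single]

/-- `detTwistVec c [gK] = c^{v(det g)} [gK]`. [folklore] -/
theorem detTwistVec_single_coe (c : Rˣ) (g : GL (Fin n) F) (r : R) :
    detTwistVec hϖ c (single (g : GL (Fin n) F ⧸ glInt n F) r) =
      single (g : GL (Fin n) F ⧸ glInt n F) (r * ((c ^ detExp hϖ g : Rˣ) : R)) := by
  rw [detTwistVec_single, detExp_out_coe]

/-- `detTwistVec c [K] = [K]`. [folklore] -/
theorem detTwistVec_single_one (c : Rˣ) (r : R) :
    detTwistVec hϖ c (single ((1 : GL (Fin n) F) : GL (Fin n) F ⧸ glInt n F) r) =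
      single ((1 : GL (Fin n) F) : GL (Fin n) F ⧸ glInt n F) r := by
  rw [detTwistVec_single_coe, detExp_one, zpow_zero, Units.val_one, mul_one]

/-- `detTwistVec c ∘ detTwistVec c' = detTwistVec (c c')`. [folklore] -/
theorem detTwistVec_comp (c c' : Rˣ) :
    detTwistVec hϖ c ∘ₗ detTwistVec hϖ c' = detTwistVec (n := n) hϖ (c * c') := by
  refine MonoidAlgebra.lhom_ext' fun γ => LinearMap.ext fun r => ?_
  simp only [LinearMap.comp_apply, MonoidAlgebra.lsingle_apply, detTwistVec_single, mul_zpow,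
    Units.val_mul, mul_assoc, mul_comm ((c' ^ detExp hϖ γ.out : Rˣ) : R)]

/-- `detTwistVec 1 = id`. [folklore] -/
theorem detTwistVec_one : detTwistVec (n := n) (R := R) hϖ 1 = LinearMap.id := by
  refine MonoidAlgebra.lhom_ext' fun γ => LinearMap.ext fun r => ?_
  simp only [LinearMap.comp_apply, MonoidAlgebra.lsingle_apply, detTwistVec_single,
    _root_.one_zpow, Units.val_one, mul_one, LinearMap.id_apply]

/-- `detTwistVec c ∘ detTwistVec c⁻¹ = id`. [folklore] -/
theorem detTwistVec_comp_inv (c : Rˣ) :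
    detTwistVec hϖ c ∘ₗ detTwistVec hϖ c⁻¹ = (LinearMap.id : MonoidAlgebra R (GL (Fin n) F ⧸ glInt n F) →ₗ[R] _) := by
  rw [detTwistVec_comp, mul_inv_cancel, detTwistVec_one]

/-- `detTwistVec c⁻¹ ∘ detTwistVec c = id`. [folklore] -/
theorem detTwistVec_inv_comp (c : Rˣ) :
    detTwistVec hϖ c⁻¹ ∘ₗ detTwistVec hϖ c = (LinearMap.id : MonoidAlgebra R (GL (Fin n) F ⧸ glInt n F) →ₗ[R] _) := by
  rw [detTwistVec_comp, inv_mul_cancel, detTwistVec_one]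

/-- **Equivariance up to the character**: `detTwistVec c ∘ π(h) = c^{v(det h)} π(h) ∘ detTwistVec c`.
[folklore] -/
theorem detTwistVec_comp_ofMulAction (c : Rˣ) (h : GL (Fin n) F) :
    detTwistVec hϖ c ∘ₗ ofMulAction R (GL (Fin n) F) (GL (Fin n) F ⧸ glInt n F) h =
      ((c ^ detExp hϖ h : Rˣ) : R) •
        (ofMulAction R (GL (Fin n) F) (GL (Fin n) F ⧸ glInt n F) h ∘ₗ detTwistVec hϖ c) := by
  refine MonoidAlgebra.lhom_ext' fun γ => LinearMap.ext fun r => ?_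
  induction γ using QuotientGroup.induction_on with
  | H g =>
    simp only [LinearMap.comp_apply, MonoidAlgebra.lsingle_apply, ofMulAction_single,
      LinearMap.smul_apply, MulAction.Quotient.smul_coe, detTwistVec_single_coe,
      MonoidAlgebra.smul_single, smul_eq_mul, detExp_mul, _root_.zpow_add, Units.val_mul]
    congr 1
    ring

/-! #### The twist of the Hecke algebra -/

/-- Conjugation by `detTwistVec c` preserves `ℋ(G, K) = End_G(R[G ⧸ K])`: the conjugate of a
`G`-endomorphism again commutes with `G`, the two scalars `c^{±v(det h)}` cancelling. [folklore] -/
theorem detTwistVec_conj_mem (c : Rˣ) (T : heckeAlgebra R (GL (Fin n) F) (glInt n F)) :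
    detTwistVec hϖ c ∘ₗ (T : Module.End R (MonoidAlgebra R (GL (Fin n) F ⧸ glInt n F))) ∘ₗ
        detTwistVec hϖ c⁻¹ ∈ heckeAlgebra R (GL (Fin n) F) (glInt n F) := by
  rw [mem_heckeAlgebra_iff]
  intro h
  have hT := (mem_heckeAlgebra_iff _).1 T.2 h
  have h1 := detTwistVec_comp_ofMulAction (R := R) hϖ c h
  have h2 := detTwistVec_comp_ofMulAction (R := R) hϖ c⁻¹ h
  rw [Module.End.mul_eq_comp, Module.End.mul_eq_comp] at hT ⊢
  set π := ofMulAction R (GL (Fin n) F) (GL (Fin n) F ⧸ glInt n F) h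
  set T' : Module.End R (MonoidAlgebra R (GL (Fin n) F ⧸ glInt n F)) :=
    (T : Module.End R (MonoidAlgebra R (GL (Fin n) F ⧸ glInt n F)))
  set D := detTwistVec (n := n) (R := R) hϖ c
  set D' := detTwistVec (n := n) (R := R) hϖ c⁻¹
  symm
  rw [LinearMap.comp_assoc, LinearMap.comp_assoc, h2, LinearMap.comp_smul, LinearMap.comp_smul,
    ← LinearMap.comp_assoc D' π T', ← hT, LinearMap.comp_assoc, ← LinearMap.comp_assoc _ π D, h1,
    LinearMap.smul_comp, smul_smul, ← Units.val_mul, _root_.inv_zpow, inv_mul_cancel,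
    Units.val_one, one_smul, LinearMap.comp_assoc]

/-- The twist as an algebra endomorphism of `ℋ(G, K)`: `T ↦ detTwistVec c ∘ T ∘ detTwistVec c⁻¹`
(see `unramifiedDetTwist`). [folklore] -/
def unramifiedDetTwistHom (c : Rˣ) :
    heckeAlgebra R (GL (Fin n) F) (glInt n F) →ₐ[R] heckeAlgebra R (GL (Fin n) F) (glInt n F) where
  toFun T := ⟨detTwistVec hϖ c ∘ₗ (T : Module.End R (MonoidAlgebra R (GL (Fin n) F ⧸ glInt n F))) ∘ₗ
    detTwistVec hϖ c⁻¹, detTwistVec_conj_mem hϖ c T⟩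
  map_one' := Subtype.ext (by
    simp only [Subalgebra.coe_one, Module.End.one_eq_id, LinearMap.id_comp, detTwistVec_comp_inv])
  map_mul' S T := Subtype.ext (by
    simp only [Subalgebra.coe_mul, Module.End.mul_eq_comp, LinearMap.comp_assoc]
    rw [← LinearMap.comp_assoc _ (detTwistVec hϖ c) (detTwistVec hϖ c⁻¹), detTwistVec_inv_comp,
      LinearMap.id_comp])
  map_zero' := Subtype.ext (by
    simp only [Subalgebra.coe_zero, LinearMap.zero_comp, LinearMap.comp_zero])
  map_add' S T := Subtype.ext (by
    simp only [Subalgebra.coe_add, LinearMap.add_comp, LinearMap.comp_add])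
  commutes' r := Subtype.ext (by
    simp only [Subalgebra.coe_algebraMap, Module.algebraMap_end_eq_smul_id, LinearMap.smul_comp,
      LinearMap.comp_smul, LinearMap.id_comp, detTwistVec_comp_inv])

/-- Unfolding of `unramifiedDetTwistHom`: conjugation by `detTwistVec c`. [folklore] -/
theorem coe_unramifiedDetTwistHom (c : Rˣ) (T : heckeAlgebra R (GL (Fin n) F) (glInt n F)) :
    (unramifiedDetTwistHom hϖ c T : Module.End R (MonoidAlgebra R (GL (Fin n) F ⧸ glInt n F))) =
      detTwistVec hϖ c ∘ₗ (T : Module.End R (MonoidAlgebra R (GL (Fin n) F ⧸ glInt n F))) ∘ₗ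
        detTwistVec hϖ c⁻¹ :=
  rfl

/-- `τ_c ∘ τ_{c'} = τ_{c c'}`. [folklore] -/
theorem unramifiedDetTwistHom_comp (c c' : Rˣ) :
    (unramifiedDetTwistHom hϖ c).comp (unramifiedDetTwistHom (n := n) hϖ c') =
      unramifiedDetTwistHom hϖ (c * c') := by
  refine AlgHom.ext fun T => Subtype.ext ?_
  rw [AlgHom.comp_apply, coe_unramifiedDetTwistHom, coe_unramifiedDetTwistHom,
    coe_unramifiedDetTwistHom, LinearMap.comp_assoc, LinearMap.comp_assoc, detTwistVec_comp,
    ← LinearMap.comp_assoc, ← LinearMap.comp_assoc, detTwistVec_comp, _root_.mul_inv_rev,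
    LinearMap.comp_assoc]

/-- `τ_1 = id`. [folklore] -/
theorem unramifiedDetTwistHom_one :
    unramifiedDetTwistHom (n := n) (R := R) hϖ 1 = AlgHom.id R _ := by
  refine AlgHom.ext fun T => Subtype.ext ?_
  rw [coe_unramifiedDetTwistHom, inv_one, detTwistVec_one, LinearMap.id_comp, LinearMap.comp_id]
  rfl

/-- **The unramified twist** of the spherical Hecke algebra by `c ∈ Rˣ`: the `R`-algebra
automorphism `τ_c` of `ℋ_R(GL_n(F), GL_n(𝒪))` with `τ_c(T_g) = c^{v(det g)} T_g`
(`unramifiedDetTwist_doubleCosetOperator`) — the effect on bi-`K`-invariant functions of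
multiplying by the unramified character `c^{v ∘ det}` of `GL_n(F)` — realised on `End_G(R[G ⧸ K])`
as conjugation by the multiplication `[γ] ↦ c^{v(det γ)} [γ]`.  If `θ` is the character by which
`ℋ` acts on the spherical line of `π` then `θ ∘ τ_c` is that of `π ⊗ (c^{v ∘ det})`, and
`𝒮(τ_c T)(x) = 𝒮(T)(c x)` (`satakeTransformModP_unramifiedDetTwist`): twisting by an unramified
character multiplies the Satake parameter by `c` (`IsSatakeParameterModP.twist`; over `ℂ` and
globally: `HasSatakeParameterAt.twist` of `AutomorphicTwistSatake`, Arthur–Clozel (1989), Ch. 3,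
proof of Thm. 3.1, `t_{π ⊗ χ, v} = χ(ϖ_v) t_{π, v}`). [folklore] -/
def unramifiedDetTwist (c : Rˣ) :
    heckeAlgebra R (GL (Fin n) F) (glInt n F) ≃ₐ[R] heckeAlgebra R (GL (Fin n) F) (glInt n F) :=
  AlgEquiv.ofAlgHom (unramifiedDetTwistHom hϖ c) (unramifiedDetTwistHom hϖ c⁻¹)
    (by rw [unramifiedDetTwistHom_comp, mul_inv_cancel, unramifiedDetTwistHom_one])
    (by rw [unramifiedDetTwistHom_comp, inv_mul_cancel, unramifiedDetTwistHom_one])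

/-- Unfolding of `unramifiedDetTwist`: conjugation by `detTwistVec c`. [folklore] -/
theorem coe_unramifiedDetTwist (c : Rˣ) (T : heckeAlgebra R (GL (Fin n) F) (glInt n F)) :
    (unramifiedDetTwist hϖ c T : Module.End R (MonoidAlgebra R (GL (Fin n) F ⧸ glInt n F))) =
      detTwistVec hϖ c ∘ₗ (T : Module.End R (MonoidAlgebra R (GL (Fin n) F ⧸ glInt n F))) ∘ₗ
        detTwistVec hϖ c⁻¹ :=
  rfl

/-- The inverse twist is the twist by `c⁻¹`. [folklore] -/
theorem unramifiedDetTwist_symm (c : Rˣ) :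
    (unramifiedDetTwist (n := n) (R := R) hϖ c).symm = unramifiedDetTwist hϖ c⁻¹ := by
  refine AlgEquiv.ext fun T => ?_
  rfl

/-- `(τ_c T) [K] = detTwistVec c (T [K])`. [folklore] -/
theorem toVector_unramifiedDetTwist (c : Rˣ) (T : heckeAlgebra R (GL (Fin n) F) (glInt n F)) :
    heckeAlgebra.toVector (glInt n F) (unramifiedDetTwist hϖ c T) =
      detTwistVec hϖ c (heckeAlgebra.toVector (glInt n F) T) := by
  rw [heckeAlgebra.toVector_apply, heckeAlgebra.toVector_apply, coe_unramifiedDetTwist,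
    LinearMap.comp_apply, LinearMap.comp_apply, detTwistVec_single_one]

variable [IsHeckeTriple (⊤ : Submonoid (GL (Fin n) F)) (glInt n F) (glInt n F)] in
/-- **`τ_c(T_g) = c^{v(det g)} T_g`**. [folklore] -/
theorem unramifiedDetTwist_doubleCosetOperator (c : Rˣ) (g : GL (Fin n) F) :
    unramifiedDetTwist hϖ c (heckeAlgebra.doubleCosetOperator (glInt n F) g) =
      ((c ^ detExp hϖ g : Rˣ) : R) • heckeAlgebra.doubleCosetOperator (glInt n F) g := by
  classical
  refine heckeAlgebra.toVector_injective (glInt n F) ?_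
  rw [toVector_unramifiedDetTwist, map_smul, heckeAlgebra.toVector_doubleCosetOperator,
    heckeAlgebra.doubleCosetIndicator_eq_sum, map_sum, Finset.smul_sum]
  refine Finset.sum_congr rfl fun γ hγ => ?_
  rw [Set.Finite.mem_toFinset] at hγ
  rw [detTwistVec_single, detExp_out_of_mem_orbit hϖ hγ, one_mul, MonoidAlgebra.smul_single,
    smul_eq_mul, mul_one]

/-! #### The twist `x^e ↦ c^{|e|} x^e` of `R[ℤⁿ]` and the Satake transform -/

/-- The monomial map `e ↦ c^{|e|} x^e`, `|e| = ∑ i, e_i`, a monoid homomorphism `ℤⁿ → R[ℤⁿ]`.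
[folklore] -/
def laurentTwistHom (c : Rˣ) : Multiplicative (Fin n → ℤ) →* AddMonoidAlgebra R (Fin n → ℤ) where
  toFun m := AddMonoidAlgebra.single (Multiplicative.toAdd m)
    ((c ^ (∑ i, Multiplicative.toAdd m i) : Rˣ) : R)
  map_one' := by
    simp only [toAdd_one, Pi.zero_apply, Finset.sum_const_zero, zpow_zero, Units.val_one]
    rfl
  map_mul' x y := by
    simp only [toAdd_mul, Pi.add_apply, Finset.sum_add_distrib, _root_.zpow_add, Units.val_mul,
      AddMonoidAlgebra.single_mul_single]

omit [ValuativeRel F] [IsDiscreteValuationRing 𝒪[F]] in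
/-- **The twist `x_i ↦ c x_i`** of the Laurent polynomial algebra: the `R`-algebra endomorphism
`x^e ↦ c^{|e|} x^e` of `R[ℤⁿ]` (pull-back along multiplication by the central element
`(c, …, c)` of the dual torus). [folklore] -/
def laurentTwist (c : Rˣ) : AddMonoidAlgebra R (Fin n → ℤ) →ₐ[R] AddMonoidAlgebra R (Fin n → ℤ) :=
  AddMonoidAlgebra.lift R (AddMonoidAlgebra R (Fin n → ℤ)) (Fin n → ℤ) (laurentTwistHom c)

omit [ValuativeRel F] [IsDiscreteValuationRing 𝒪[F]] in
/-- `laurentTwist c (r x^e) = c^{|e|} r x^e`. [folklore] -/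
theorem laurentTwist_single (c : Rˣ) (e : Fin n → ℤ) (r : R) :
    laurentTwist c (AddMonoidAlgebra.single e r) =
      AddMonoidAlgebra.single e (r * ((c ^ (∑ i, e i) : Rˣ) : R)) := by
  rw [laurentTwist, AddMonoidAlgebra.lift_single]
  change r • AddMonoidAlgebra.single e _ = _
  rw [AddMonoidAlgebra.smul_single, smul_eq_mul]
  rfl

omit [ValuativeRel F] [IsDiscreteValuationRing 𝒪[F]] in
/-- **Evaluation after the twist is evaluation at `c a`**: `ev_a ∘ (x_i ↦ c x_i) = ev_{c a}` (over a
field `k`, with `laurentEval` of `TorusCharacters`). [folklore] -/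
theorem laurentEval_comp_laurentTwist {k : Type*} [Field k] (a : Fin n → kˣ) (c : kˣ) :
    (laurentEval a).comp (laurentTwist c) = laurentEval fun i => c * a i := by
  refine AddMonoidAlgebra.algHom_ext (fun m => ?_) (Subsingleton.elim _ _)
  rw [AlgHom.comp_apply, laurentTwist_single, laurentEval_single, laurentEval_single, one_mul,
    one_mul, ← Units.val_mul]
  congr 1
  rw [← prod_zpow_eq_zpow_sum', ← Finset.prod_mul_distrib]
  exact Finset.prod_congr rfl fun i _ => by rw [mul_zpow]

variable (hq : IsUnit ((Nat.card 𝓀[F] : ℕ) : R))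

/-- The vector transform intertwines the two twists:
`satakeVecModP ∘ detTwistVec c = laurentTwist c ∘ satakeVecModP` (`v(det γ) = |e(γ)|`).
[folklore] -/
theorem satakeVecModP_comp_detTwistVec (c : Rˣ) :
    satakeVecModP hϖ hq ∘ₗ detTwistVec hϖ c =
      (laurentTwist c).toLinearMap ∘ₗ satakeVecModP (n := n) hϖ hq := by
  refine MonoidAlgebra.lhom_ext' fun γ => LinearMap.ext fun r => ?_
  simp only [LinearMap.comp_apply, MonoidAlgebra.lsingle_apply, detTwistVec_single,
    satakeVecModP_single, AlgHom.toLinearMap_apply, laurentTwist_single, detExp]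
  congr 1
  ring

/-- **The Satake transform of a twist**: `𝒮_R(τ_c T) = (x_i ↦ c x_i)(𝒮_R T)`, i.e.
`𝒮(τ_c T)(x) = 𝒮(T)(c x)`. [folklore] -/
theorem satakeTransformModP_unramifiedDetTwist (c : Rˣ)
    (T : heckeAlgebra R (GL (Fin n) F) (glInt n F)) :
    satakeTransformModP hϖ hq (unramifiedDetTwist hϖ c T) =
      laurentTwist c (satakeTransformModP hϖ hq T) := by
  rw [satakeTransformModP_apply, satakeTransformModP_apply, toVector_unramifiedDetTwist,
    ← LinearMap.comp_apply (f := satakeVecModP hϖ hq), satakeVecModP_comp_detTwistVec,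
    LinearMap.comp_apply, AlgHom.toLinearMap_apply]

/-- The same, as an identity of algebra maps: `𝒮_R ∘ τ_c = (x_i ↦ c x_i) ∘ 𝒮_R`. [folklore] -/
theorem satakeTransformModP_comp_unramifiedDetTwist (c : Rˣ) :
    (satakeTransformModP hϖ hq).comp (unramifiedDetTwist hϖ c).toAlgHom =
      (laurentTwist c).comp (satakeTransformModP (n := n) hϖ hq) :=
  AlgHom.ext fun T => satakeTransformModP_unramifiedDetTwist hϖ hq c T

end Twist

section TwistParameter

variable {k : Type*} [Field k]
variable [IsDiscreteValuationRing 𝒪[F]] {ϖ : F} {hϖ : IsUniformizingElement ϖ}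
  {hq : IsUnit ((Nat.card 𝓀[F] : ℕ) : k)}
  {θ : heckeAlgebra k (GL (Fin n) F) (glInt n F) →ₐ[k] k} {α : Multiset kˣ}

/-- **Satake parameters of an unramified twist**: if `θ` has Satake parameter `α` then
`θ ∘ τ_c` has Satake parameter `c α = {c α_1, …, c α_n}` (Arthur–Clozel (1989), Ch. 3, proof of
Thm. 3.1: `t_{π ⊗ χ, v} = χ(ϖ_v) t_{π,v}`; here for characters of the Hecke algebra with
coefficients in any field in which `q ≠ 0`). [folklore] -/
theorem IsSatakeParameterModP.twist (h : IsSatakeParameterModP hϖ hq θ α) (c : kˣ) :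
    IsSatakeParameterModP hϖ hq (θ.comp (unramifiedDetTwist hϖ c).toAlgHom)
      (α.map fun u => c * u) := by
  obtain ⟨a, rfl, rfl⟩ := h
  refine ⟨fun i => c * a i, by rw [Multiset.map_map]; rfl, ?_⟩
  rw [AlgHom.comp_assoc, satakeTransformModP_comp_unramifiedDetTwist, ← AlgHom.comp_assoc,
    laurentEval_comp_laurentTwist]

end TwistParameter

end Literature.NumberTheory.Automorphic
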